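import Summits.AnomalousDissipation.AnomalousDissipation.Theorems.SawtoothPulseCascadeK1LocalisedCascadeShiftBookkeeping
import Summits.AnomalousDissipation.AnomalousDissipation.Theorems.SawtoothPulseCascadeK1LocalisedCascadeSpectralCommutator

/-!
# K1loc, line `Spectral` / SeqCone — helper: THE TWO-BRANCH ENERGY STEP WITH ITS CROSS TERM DISCHARGED (T1, second brick)

Helper file of the prover lane on the crux `K1LocalisedCascade` (stmt-AnomalousDissipation-19491), route
`SawtoothPulseCascade` (memo v4 §3, target T1).  g0's `tsum_symbol_sq_three_piece_le` (`…ShiftBookkeeping`) bounds the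
symbol energy of `H = e_{q⁺}Ξ⁺F + e_{q⁻}Ξ⁻F + E` with the cross terms as INPUTS.  When the zone part has been junked first
(`…SlotRestart`, memo v4 §2) `E = 0`, and the remaining `±` cross term is a COMMUTATOR: with the shifted symbol
`k ↦ m(k + q⁺)`, `Θ₁ = Ξ⁺` (unmodulated, small `ω₂`-moment) and `Θ₂ = e_{q⁻−q⁺}Ξ⁻` (disjoint from `Ξ⁺`), g0's
`norm_tsum_symbol_sq_cross_le` applies after reindexing `k ↦ k + q⁺` (`mFourierCoeff_mFourier_mul`).  Result
(`tsum_symbol_sq_twoBranch_le`):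
  `Σ' m²|𝓕(e_{q⁺}Ξ⁺F + e_{q⁻}Ξ⁻F)|² ≤ (√Σ' m(k+q⁺)²|𝓕F|² + A⁺‖F‖)² + (√Σ' m(k+q⁻)²|𝓕F|² + A⁻‖F‖)² + 2(Σ ω₂|𝓕Ξ⁺|)‖F‖²`.
No definitions; no statement about the stub.
[cite: Grafakos2014, Prop. 3.1.2 (5) (coefficients of products and modulations) and Prop. 3.2.7 (3) (Parseval)] [problem: turb]
-/

-- `Summit.<Summit>.<Problem>`: single-conjunct summit, the duplicate namespace segment is deliberate.
set_option linter.dupNamespace false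

noncomputable section

namespace Summit.AnomalousDissipation.AnomalousDissipation.Theorems.SawtoothPulseCascade.K1Slot

open MeasureTheory Set Filter Topology UnitAddTorus Function
open scoped ComplexConjugate
open Literature.Analysis Literature.Analysis.FunctionSpaces Literature.Analysis.FunctionSpaces.Torus
open Summit.AnomalousDissipation.AnomalousDissipation.Theorems.SawtoothPulseCascade.SpectralLeakage

variable {d : Type*} [Fintype d]

/-- **Reindexing the `±` cross term.**  `Σ'ₖ m(k)² 𝓕(e_{q⁺}Ξ⁺F)(k) conj 𝓕(e_{q⁻}Ξ⁻F)(k)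
 = Σ'ₖ m(k+q⁺)² 𝓕(Ξ⁺F)(k) conj 𝓕(e_{q⁻−q⁺}Ξ⁻F)(k)` (shift rule and the bijection `k ↦ k + q⁺`).
[cite: Grafakos2014, Prop. 3.1.2 (5)] -/
theorem tsum_cross_reindex (F Ξp Ξm : UnitAddTorus d → ℂ) (qp qm : d → ℤ) (m : (d → ℤ) → ℝ) :
    ∑' k, ((m k ^ 2 : ℝ) : ℂ) * mFourierCoeff (fun x => mFourier qp x * (Ξp x * F x)) k *
        conj (mFourierCoeff (fun x => mFourier qm x * (Ξm x * F x)) k) =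
      ∑' k, ((m (k + qp) ^ 2 : ℝ) : ℂ) * mFourierCoeff (fun x => Ξp x * F x) k *
        conj (mFourierCoeff (fun x => mFourier (qm - qp) x * (Ξm x * F x)) k) := by
  rw [← (Equiv.addRight qp).tsum_eq]
  refine tsum_congr fun k => ?_
  simp only [Equiv.coe_addRight, mFourierCoeff_mFourier_mul, add_sub_cancel_right]
  congr 2
  rw [show k + qp - qm = k - (qm - qp) by abel]

/-- **The two-branch energy step with the cross term discharged.**  For continuous `F` with summable coefficients,
smooth-enough localisers `Ξ⁺, Ξ⁻` (continuous, summable coefficients, `|Ξ^±| ≤ 1`, DISJOINT: `conj Ξ⁺ · Ξ⁻ = 0`), integer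
shifts `q⁺, q⁻`, a real symbol `m` (`|m| ≤ M`) with moduli `ω` for `m` and `ω₂` for `m²`:
`Σ' m²|𝓕(e_{q⁺}Ξ⁺F + e_{q⁻}Ξ⁻F)|² ≤ (√Σ' m(k+q⁺)²|𝓕F|² + (Σω|𝓕Ξ⁺|)‖F‖)² + (√Σ' m(k+q⁻)²|𝓕F|² + (Σω|𝓕Ξ⁻|)‖F‖)²
  + 2 (Σ ω₂|𝓕Ξ⁺|) ∫|F|²`. [cite: Grafakos2014, Prop. 3.1.2 (5) and Prop. 3.2.7 (3)] -/
theorem tsum_symbol_sq_twoBranch_le {F Ξp Ξm : UnitAddTorus d → ℂ} (hF : Continuous F)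
    (hFs : Summable fun k => ‖mFourierCoeff F k‖) (hΞp : Continuous Ξp) (hΞps : Summable fun k => ‖mFourierCoeff Ξp k‖)
    (hΞp1 : ∀ x, ‖Ξp x‖ ≤ 1) (hΞm : Continuous Ξm) (hΞms : Summable fun k => ‖mFourierCoeff Ξm k‖)
    (hΞm1 : ∀ x, ‖Ξm x‖ ≤ 1) (hdis : ∀ x, conj (Ξp x) * Ξm x = 0) (qp qm : d → ℤ)
    {m : (d → ℤ) → ℝ} {M : ℝ} (hmM : ∀ k, |m k| ≤ M) {ω : (d → ℤ) → ℝ} (hω0 : ∀ n, 0 ≤ ω n)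
    (hω : ∀ k n, |m k - m (k - n)| ≤ ω n) (hωp : Summable fun n => ω n * ‖mFourierCoeff Ξp n‖)
    (hωm : Summable fun n => ω n * ‖mFourierCoeff Ξm n‖) {ω₂ : (d → ℤ) → ℝ} (hω₂0 : ∀ n, 0 ≤ ω₂ n)
    (hω₂ : ∀ k n, |m k ^ 2 - m (k - n) ^ 2| ≤ ω₂ n) (hω₂s : Summable fun n => ω₂ n * ‖mFourierCoeff Ξp n‖) :
    ∑' k, m k ^ 2 * ‖mFourierCoeff (fun x => mFourier qp x * (Ξp x * F x) + mFourier qm x * (Ξm x * F x)) k‖ ^ 2 ≤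
      (Real.sqrt (∑' k, m (k + qp) ^ 2 * ‖mFourierCoeff F k‖ ^ 2) +
          (∑' n, ω n * ‖mFourierCoeff Ξp n‖) * Real.sqrt (∫ x, ‖F x‖ ^ 2)) ^ 2 +
        (Real.sqrt (∑' k, m (k + qm) ^ 2 * ‖mFourierCoeff F k‖ ^ 2) +
          (∑' n, ω n * ‖mFourierCoeff Ξm n‖) * Real.sqrt (∫ x, ‖F x‖ ^ 2)) ^ 2 +
        2 * ((∑' n, ω₂ n * ‖mFourierCoeff Ξp n‖) * ∫ x, ‖F x‖ ^ 2) := by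
  -- the cross term, via the shifted symbol and the disjoint pair `(Ξ⁺, e_{q⁻−q⁺}Ξ⁻)`
  have hΘ₂ : Continuous (fun x => mFourier (qm - qp) x * Ξm x) := (mFourier (qm - qp)).continuous.mul hΞm
  have hΘ₂1 : ∀ x, ‖mFourier (qm - qp) x * Ξm x‖ ≤ 1 := fun x => by
    rw [norm_mul]
    have h1 : ‖mFourier (qm - qp) x‖ = 1 := by
      rw [Torus.mFourier_apply_eq_prod, norm_prod]
      exact Finset.prod_eq_one fun l _ => Circle.norm_coe _
    rw [h1, one_mul]; exact hΞm1 x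
  have hdis' : ∀ x, conj (Ξp x) * (mFourier (qm - qp) x * Ξm x) = 0 := fun x => by
    rw [mul_left_comm, hdis x, mul_zero]
  have hmM' : ∀ k, |m (k + qp)| ≤ M := fun k => hmM _
  have hω₂' : ∀ k n, |m (k + qp) ^ 2 - m (k + qp - n) ^ 2| ≤ ω₂ n := fun k n => by
    have := hω₂ (k + qp) n; rwa [show k + qp - n = k + qp - n from rfl] at this
  have hcross := norm_tsum_symbol_sq_cross_le (m := fun k => m (k + qp)) hF hFs hΞp hΞps hΘ₂ hΘ₂1 hdis' hmM' hω₂0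
    (fun k n => by simpa [add_sub_right_comm] using hω₂' k n) hω₂s
  have hc : ‖∑' k, ((m k ^ 2 : ℝ) : ℂ) * mFourierCoeff (fun x => mFourier qp x * (Ξp x * F x)) k *
      conj (mFourierCoeff (fun x => mFourier qm x * (Ξm x * F x)) k)‖ ≤
      (∑' n, ω₂ n * ‖mFourierCoeff Ξp n‖) * ∫ x, ‖F x‖ ^ 2 := by
    rw [tsum_cross_reindex]
    have e : (fun x => mFourier (qm - qp) x * Ξm x * F x) = fun x => mFourier (qm - qp) x * (Ξm x * F x) := by
      funext x; ring
    simpa only [e] using hcross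
  -- the three-piece lemma with `E = 0`
  have h3 := tsum_symbol_sq_three_piece_le (E := fun _ => (0 : ℂ)) hF hFs hΞp hΞps hΞp1 hΞm hΞms hΞm1 continuous_const
    qp qm (H := fun x => mFourier qp x * (Ξp x * F x) + mFourier qm x * (Ξm x * F x))
    (by funext x; simp) hmM hω0 hω hωp hωm hc (cp := 0) (cm := 0)
    (by simp [mFourierCoeff_eq_integral_volume]) (by simp [mFourierCoeff_eq_integral_volume])
  have hM0 : 0 ≤ M := (abs_nonneg _).trans (hmM 0)
  simpa using h3

end Summit.AnomalousDissipation.AnomalousDissipation.Theorems.SawtoothPulseCascade.K1Slot
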